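import Summits.ValiantsHypothesis.ValiantsHypothesis.Theorems.KPlusLogSqLawTropicalSymmetricThreeFourSeventeen

/-!
# Route «KPlusLogSqLaw» — the SYMMETRIC `(3,4)` tropical row — the four exclusion lemmas behind `T_sym(3,4) ≤ 16`
# (abstract, over terms of `S₃ × (Fin 3 → Fin 4)` with the pairwise exchange hypotheses)

HONEST FRAMING.  Helper file (seat val-sym-lift-p2 (g5), cell `pub-symmetroid`, 2026-08-27; `--supports` the `WeakLifting` item
stmt-ValiantsHypothesis-19561 as a helper, no closure claim).  A SMALL-FORMAT statement in the single-term-carrier model, far inside the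
known regime of the cruxes; nothing here is about `TropicalB` / `WeakLifting` in their windows, Conjecture B, the real census numeral of
Door A at `(3,4)` (`PosRootLawAt 3 4 18`, OPEN, never asserted), `MatrixDescartes` (stmt-ValiantsHypothesis-18050) or VP ≠ VNP.  Kernel
window after this file: `15 ≤ T^single_sym(3,4) ≤ 16` (floor p469079; cell level `= 15`, two codes; the last unit needs the sign rules).

THIS FILE: the abstract exclusion lemmas X1, X2, Y1, Y2 (hypotheses = cycle-constancy `h1`, same-row monotonicity `h2`, crossing
cancellation `h6`/`h7` in `g`-form, monotonicity of `g` on occurring classes `h8`); the count and the instantiation are in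
`…TropicalSymmetricThreeFourSixteen.lean`.

PROOF (face-free).  Classes by exponent rank; carriers `D(u)` (identity) or crossing terms; rules: single-entry exchange
(`d_lt_of_dominant_entry`), crossing cancellation in both orders (`d_add_d_lt_of_dominant_cross`), distinct multisets
(`slope_lt_of_dominant`).  LEMMA X (as in `…Seventeen`): `{003}` excludes `{012}`, `{033}` excludes `{123}` — two misses.  LEMMA Y:
`{013}` (= `D(u)`) and `{112}` both carried ⇒ `g 0 + g 3 < 2·g 1` (`g` = exponents listed by rank): `{112} = D(1,1,2)` is incomparable
with `u`; `{112} = T_k(2;1)` before `D(u)` forces `u_k = 3` and the cancellation `2·g 1 < g 0 + g 1` is absurd; after `D(u)` it forces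
`u_k ≤ 2`, `u_k = 0` gives `g 1 + g 3 < 2·g 1` (absurd), so `u_k = 1` and the cancellation reads `g 0 + g 3 < 2·g 1`.  Mirror LEMMA Y′:
`{023}` and `{122}` both carried ⇒ `2·g 2 < g 0 + g 3`.  As `g 1 ≤ g 2`, Y and Y′ cannot both fire: a THIRD multiset is missed ⇒
`n + 1 ≤ 17`.  (This is exactly the sign-free optimum `17` terms of the cell's pairwise DP, now explained face-free; the signed optimum
`16` terms needs the sign rules — NOT claimed.) [cell statement R1624 (a) «conceptual lemma»; folklore-level exchange argument]
-/

set_option linter.dupNamespace false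
set_option autoImplicit false

namespace Summit.ValiantsHypothesis.ValiantsHypothesis.Theorems.KPlusLogSqLaw

open Summit.ValiantsHypothesis.ValiantsHypothesis.Theorems.MatrixDescartes.Negative
open Summit.ValiantsHypothesis.ValiantsHypothesis.Theorems.LacunarySymmetroidMatrixDescartes
open Summit.ValiantsHypothesis.ValiantsHypothesis.Theorems.LacunarySymmetroidMatrixDescartes.TropicalCensus
open Finset

namespace SymmetricThreeFourSixteen

open SymmetricThreeFour SymmetricThreeFourSeventeen

/-! ## 1. Small facts -/

/-- class counts of the pattern vector `(0,1,3)`. -/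
theorem cnt013 : ∀ l : Fin 4, (univ.filter fun i : Fin 3 => (![0, 1, 3] : Fin 3 → Fin 4) i = l).card = (![1, 1, 0, 1] : Fin 4 → ℕ) l := by
  decide
/-- class counts of the pattern vector `(1,1,2)`. -/
theorem cnt112 : ∀ l : Fin 4, (univ.filter fun i : Fin 3 => (![1, 1, 2] : Fin 3 → Fin 4) i = l).card = (![0, 2, 1, 0] : Fin 4 → ℕ) l := by
  decide
/-- class counts of the pattern vector `(0,2,3)`. -/
theorem cnt023 : ∀ l : Fin 4, (univ.filter fun i : Fin 3 => (![0, 2, 3] : Fin 3 → Fin 4) i = l).card = (![1, 0, 1, 1] : Fin 4 → ℕ) l := by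
  decide
/-- class counts of the pattern vector `(1,2,2)`. -/
theorem cnt122 : ∀ l : Fin 4, (univ.filter fun i : Fin 3 => (![1, 2, 2] : Fin 3 → Fin 4) i = l).card = (![0, 1, 2, 0] : Fin 4 → ℕ) l := by
  decide

/-- the non-identity permutations of `Fin 3` with a fixed point are involutions. -/
theorem swap_back : ∀ σ : Equiv.Perm (Fin 3), σ ≠ 1 → (∃ k, σ k = k) → ∀ i, σ (σ i) = i := by decide

/-- equal patterns have equal count vectors. -/
theorem counts_eq_of_classSym_eq {w w' : Fin 3 → Fin 4}
    (h : TropicalCensus.classSym ((1 : Equiv.Perm (Fin 3)), w) = TropicalCensus.classSym ((1 : Equiv.Perm (Fin 3)), w')) :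
    (fun l : Fin 4 => (univ.filter fun i : Fin 3 => w i = l).card) = fun l => (univ.filter fun i : Fin 3 => w' i = l).card :=
  funext fun l => card_filter_eq_of_classSym_eq h l

/-- a class occurring once occurs nowhere else. -/
theorem ne_of_card_one (u : Fin 3 → Fin 4) (l : Fin 4) (h : (univ.filter fun i => u i = l).card = 1) {k i : Fin 3}
    (hk : u k = l) (hik : i ≠ k) : u i ≠ l := by
  intro hi
  have hsub : ({i, k} : Finset (Fin 3)) ⊆ univ.filter fun x => u x = l := by
    intro x hx
    rw [mem_insert, mem_singleton] at hx
    rw [mem_filter]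
    rcases hx with rfl | rfl
    · exact ⟨mem_univ _, hi⟩
    · exact ⟨mem_univ _, hk⟩
  have h2 := card_le_card hsub
  rw [card_pair hik, h] at h2
  exact absurd h2 (by decide)

/-- `Fin 4` bookkeeping. -/
theorem f4_a : ∀ x : Fin 4, x ≠ 2 → x ≤ 2 → x = 0 ∨ x = 1 := by decide
/-- `Fin 4` bookkeeping. -/
theorem f4_b : ∀ x : Fin 4, x ≠ 0 → 1 ≤ x := by decide
/-- `Fin 4` bookkeeping. -/
theorem f4_c : ∀ x : Fin 4, x ≠ 1 → x ≠ 2 → x = 0 ∨ x = 3 := by decide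
/-- `Fin 4` bookkeeping. -/
theorem f4_d : ∀ x : Fin 4, 2 ≤ x → x ≠ 2 → x = 3 := by decide
/-- `Fin 4` bookkeeping. -/
theorem f4_e : ∀ x : Fin 4, x ≠ 3 → x ≠ 2 → x ≤ 1 := by decide
/-- `Fin 4` bookkeeping. -/
theorem f4_f : ∀ x : Fin 4, x ≤ 1 → x ≠ 1 → x = 0 := by decide
/-- `Fin 4` bookkeeping. -/
theorem f4_g : ∀ x : Fin 4, x ≠ 0 → x ≠ 1 → 2 ≤ x := by decide
/-- `Fin 4` bookkeeping. -/
theorem f4_h : ∀ x : Fin 4, 1 ≤ x → x ≠ 1 → x = 2 ∨ x = 3 := by decide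
/-- `Fin 4` bookkeeping. -/
theorem f4_i : ∀ x : Fin 4, x ≠ 3 → x ≤ 2 := by decide

/-- the moved pair of a non-identity permutation of `Fin 3` with a fixed point `k`. -/
theorem moved_pair (σ : Equiv.Perm (Fin 3)) (k : Fin 3) (hne : σ ≠ 1) (hk : σ k = k) :
    ∃ i j : Fin 3, i ≠ j ∧ σ i = j ∧ σ j = i ∧ i ≠ k ∧ j ≠ k := by
  obtain ⟨i, hi⟩ : ∃ i, σ i ≠ i := not_forall.mp fun h => hne (Equiv.ext h)
  have hback := swap_back _ hne ⟨k, hk⟩ i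
  refine ⟨i, σ i, hi.symm, rfl, hback, ?_, ?_⟩
  · rintro rfl; exact hi hk
  · intro hj
    have : i = k := by rw [← hback, hj, hk]
    subst this
    exact hi hk

/-! ## 2. The exclusion lemmas -/

/-- **Lemma X1**: the multisets `{0,0,3}` and `{0,1,2}` are not both carried. [exchange argument] -/
theorem lemmaX1 {n : ℕ} (r : Fin (n + 1) → Equiv.Perm (Fin 3) × (Fin 3 → Fin 4)) (g : Fin 4 → ℕ)
    (h1 : ∀ k i, (r k).2 ((r k).1 i) = (r k).2 i)
    (h2 : ∀ a b : Fin (n + 1), a < b → ∀ i, (r a).1 i = (r b).1 i → (r a).2 i ≤ (r b).2 i)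
    (h6 : ∀ a b : Fin (n + 1), a < b → (r a).1 = 1 → ∀ i j : Fin 3, i ≠ j → (r b).1 i = j → (r b).1 j = i →
      g ((r a).2 i) + g ((r a).2 j) < 2 * g ((r b).2 i))
    (h8 : ∀ (a b : Fin (n + 1)) (i j : Fin 3), (r a).2 i ≤ (r b).2 j → g ((r a).2 i) ≤ g ((r b).2 j)) : ∀ a b : Fin (n + 1),
    TropicalCensus.classSym (r a) = TropicalCensus.classSym ((1 : Equiv.Perm (Fin 3)), (![0, 0, 3] : Fin 3 → Fin 4)) →
    TropicalCensus.classSym (r b) = TropicalCensus.classSym ((1 : Equiv.Perm (Fin 3)), (![0, 1, 2] : Fin 3 → Fin 4)) → False := by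
  intro a b ha hb
  have ca : ∀ l, (univ.filter fun i => (r a).2 i = l).card = (![2, 0, 0, 1] : Fin 4 → ℕ) l :=
    fun l => (card_filter_eq_of_classSym_eq ha l).trans (cnt003 l)
  have cb : ∀ l, (univ.filter fun i => (r b).2 i = l).card = (![1, 1, 1, 0] : Fin 4 → ℕ) l :=
    fun l => (card_filter_eq_of_classSym_eq hb l).trans (cnt012 l)
  have hb1 : (r b).1 = 1 := perm_eq_one_of_card_le_one _ (h1 b) fun l => by
    rw [cb l]; fin_cases l <;> decide
  have hab : a ≠ b := by
    intro h; have := ca 0; rw [h, cb 0] at this; exact absurd this (by decide)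
  have hb3 : ∀ i, (r b).2 i ≠ 3 := ne_of_card_zero _ 3 (by rw [cb 3]; rfl)
  have hb0 : ∀ i j, i ≠ j → (r b).2 i = 0 → (r b).2 j = 0 → False := by
    intro i j hij hi hj
    have h2le := two_le_card_filter (r b) hij (hi.trans hj.symm)
    rw [hj, cb 0] at h2le
    exact absurd h2le (by decide)
  by_cases ha1 : (r a).1 = 1
  · rcases lt_or_gt_of_ne hab with hlt | hlt
    · obtain ⟨k, hk⟩ := exists_of_card_pos _ 3 (by rw [ca 3]; decide)
      have hle := h2 a b hlt k (by rw [ha1, hb1])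
      rw [hk] at hle
      exact hb3 k (le_antisymm (Fin.le_last _) hle)
    · obtain ⟨i, j, hij, hi, hj⟩ := exists_pair_of_card_two _ 0 (ca 0)
      have hi' := h2 b a hlt i (by rw [ha1, hb1])
      have hj' := h2 b a hlt j (by rw [ha1, hb1])
      rw [hi] at hi'; rw [hj] at hj'
      exact hb0 i j hij (le_antisymm hi' (Fin.zero_le _)) (le_antisymm hj' (Fin.zero_le _))
  · obtain ⟨hmov, hfix, k, hk⟩ := transposition_served (r a) 0 3 (h1 a) ha1 (by rw [ca 3]; rfl)
      (fun l hl => by rw [ca l]; fin_cases l <;> first | decide | exact absurd rfl hl)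
    rcases lt_or_gt_of_ne hab with hlt | hlt
    · have hle := h2 a b hlt k (by rw [hk, hb1, Equiv.Perm.one_apply])
      rw [hfix k hk] at hle
      exact hb3 k (le_antisymm (Fin.le_last _) hle)
    · -- D before T: the crossing cancellation with the 2-cycle class `0` is absurd
      obtain ⟨i, j, hij, hij1, hji1, -, -⟩ := moved_pair (r a).1 k ha1 hk
      have hi0 : (r a).2 i = 0 := hmov i (by rw [hij1]; exact hij.symm)
      have hC := h6 b a hlt hb1 i j hij hij1 hji1
      have g1 := h8 a b i i (by rw [hi0]; exact Fin.zero_le _)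
      have g2 := h8 a b i j (by rw [hi0]; exact Fin.zero_le _)
      omega

/-- **Lemma X2** (mirror): `{0,3,3}` and `{1,2,3}` are not both carried. [exchange argument] -/
theorem lemmaX2 {n : ℕ} (r : Fin (n + 1) → Equiv.Perm (Fin 3) × (Fin 3 → Fin 4)) (g : Fin 4 → ℕ)
    (h1 : ∀ k i, (r k).2 ((r k).1 i) = (r k).2 i)
    (h2 : ∀ a b : Fin (n + 1), a < b → ∀ i, (r a).1 i = (r b).1 i → (r a).2 i ≤ (r b).2 i)
    (h7 : ∀ a b : Fin (n + 1), a < b → (r b).1 = 1 → ∀ i j : Fin 3, i ≠ j → (r a).1 i = j → (r a).1 j = i →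
      2 * g ((r a).2 i) < g ((r b).2 i) + g ((r b).2 j))
    (h8 : ∀ (a b : Fin (n + 1)) (i j : Fin 3), (r a).2 i ≤ (r b).2 j → g ((r a).2 i) ≤ g ((r b).2 j)) : ∀ a b : Fin (n + 1),
    TropicalCensus.classSym (r a) = TropicalCensus.classSym ((1 : Equiv.Perm (Fin 3)), (![0, 3, 3] : Fin 3 → Fin 4)) →
    TropicalCensus.classSym (r b) = TropicalCensus.classSym ((1 : Equiv.Perm (Fin 3)), (![1, 2, 3] : Fin 3 → Fin 4)) → False := by
  intro a b ha hb
  have ca : ∀ l, (univ.filter fun i => (r a).2 i = l).card = (![1, 0, 0, 2] : Fin 4 → ℕ) l :=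
    fun l => (card_filter_eq_of_classSym_eq ha l).trans (cnt033 l)
  have cb : ∀ l, (univ.filter fun i => (r b).2 i = l).card = (![0, 1, 1, 1] : Fin 4 → ℕ) l :=
    fun l => (card_filter_eq_of_classSym_eq hb l).trans (cnt123 l)
  have hb1 : (r b).1 = 1 := perm_eq_one_of_card_le_one _ (h1 b) fun l => by
    rw [cb l]; fin_cases l <;> decide
  have hab : a ≠ b := by
    intro h; have := ca 0; rw [h, cb 0] at this; exact absurd this (by decide)
  have hb0 : ∀ i, (r b).2 i ≠ 0 := ne_of_card_zero _ 0 (by rw [cb 0]; rfl)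
  have hb3 : ∀ i j, i ≠ j → (r b).2 i = 3 → (r b).2 j = 3 → False := by
    intro i j hij hi hj
    have h2le := two_le_card_filter (r b) hij (hi.trans hj.symm)
    rw [hj, cb 3] at h2le
    exact absurd h2le (by decide)
  by_cases ha1 : (r a).1 = 1
  · rcases lt_or_gt_of_ne hab with hlt | hlt
    · obtain ⟨i, j, hij, hi, hj⟩ := exists_pair_of_card_two _ 3 (ca 3)
      have hi' := h2 a b hlt i (by rw [ha1, hb1])
      have hj' := h2 a b hlt j (by rw [ha1, hb1])
      rw [hi] at hi'; rw [hj] at hj'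
      exact hb3 i j hij (le_antisymm (Fin.le_last _) hi') (le_antisymm (Fin.le_last _) hj')
    · obtain ⟨k, hk⟩ := exists_of_card_pos _ 0 (by rw [ca 0]; decide)
      have hle := h2 b a hlt k (by rw [ha1, hb1])
      rw [hk] at hle
      exact hb0 k (le_antisymm hle (Fin.zero_le _))
  · obtain ⟨hmov, hfix, k, hk⟩ := transposition_served (r a) 3 0 (h1 a) ha1 (by rw [ca 0]; rfl)
      (fun l hl => by rw [ca l]; fin_cases l <;> first | decide | exact absurd rfl hl)
    rcases lt_or_gt_of_ne hab with hlt | hlt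
    · -- T before D: the crossing cancellation with the 2-cycle class `3` is absurd
      obtain ⟨i, j, hij, hij1, hji1, -, -⟩ := moved_pair (r a).1 k ha1 hk
      have hi3 : (r a).2 i = 3 := hmov i (by rw [hij1]; exact hij.symm)
      have hC := h7 a b hlt hb1 i j hij hij1 hji1
      have g1 := h8 b a i i (by rw [hi3]; exact Fin.le_last _)
      have g2 := h8 b a j i (by rw [hi3]; exact Fin.le_last _)
      omega
    · have hle := h2 b a hlt k (by rw [hk, hb1, Equiv.Perm.one_apply])
      rw [hfix k hk] at hle
      exact hb0 k (le_antisymm hle (Fin.zero_le _))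

/-- **Lemma Y1**: if `{0,1,3}` and `{1,1,2}` are both carried then `g 0 + g 3 < 2·g 1`. [exchange argument] -/
theorem lemmaY1 {n : ℕ} (r : Fin (n + 1) → Equiv.Perm (Fin 3) × (Fin 3 → Fin 4)) (g : Fin 4 → ℕ)
    (h1 : ∀ k i, (r k).2 ((r k).1 i) = (r k).2 i)
    (h2 : ∀ a b : Fin (n + 1), a < b → ∀ i, (r a).1 i = (r b).1 i → (r a).2 i ≤ (r b).2 i)
    (h6 : ∀ a b : Fin (n + 1), a < b → (r a).1 = 1 → ∀ i j : Fin 3, i ≠ j → (r b).1 i = j → (r b).1 j = i →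
      g ((r a).2 i) + g ((r a).2 j) < 2 * g ((r b).2 i))
    (h7 : ∀ a b : Fin (n + 1), a < b → (r b).1 = 1 → ∀ i j : Fin 3, i ≠ j → (r a).1 i = j → (r a).1 j = i →
      2 * g ((r a).2 i) < g ((r b).2 i) + g ((r b).2 j))
    (h8 : ∀ (a b : Fin (n + 1)) (i j : Fin 3), (r a).2 i ≤ (r b).2 j → g ((r a).2 i) ≤ g ((r b).2 j)) : ∀ a b : Fin (n + 1),
    TropicalCensus.classSym (r a) = TropicalCensus.classSym ((1 : Equiv.Perm (Fin 3)), (![0, 1, 3] : Fin 3 → Fin 4)) →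
    TropicalCensus.classSym (r b) = TropicalCensus.classSym ((1 : Equiv.Perm (Fin 3)), (![1, 1, 2] : Fin 3 → Fin 4)) →
    g 0 + g 3 < 2 * g 1 := by
  intro a b ha hb
  have ca : ∀ l, (univ.filter fun i => (r a).2 i = l).card = (![1, 1, 0, 1] : Fin 4 → ℕ) l :=
    fun l => (card_filter_eq_of_classSym_eq ha l).trans (cnt013 l)
  have cb : ∀ l, (univ.filter fun i => (r b).2 i = l).card = (![0, 2, 1, 0] : Fin 4 → ℕ) l :=
    fun l => (card_filter_eq_of_classSym_eq hb l).trans (cnt112 l)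
  have ha1 : (r a).1 = 1 := perm_eq_one_of_card_le_one _ (h1 a) fun l => by
    rw [ca l]; fin_cases l <;> decide
  have hab : a ≠ b := by
    intro h; have := ca 0; rw [h, cb 0] at this; exact absurd this (by decide)
  have ua2 : ∀ i, (r a).2 i ≠ 2 := ne_of_card_zero _ 2 (by rw [ca 2]; rfl)
  have wb0 : ∀ i, (r b).2 i ≠ 0 := ne_of_card_zero _ 0 (by rw [cb 0]; rfl)
  have wb3 : ∀ i, (r b).2 i ≠ 3 := ne_of_card_zero _ 3 (by rw [cb 3]; rfl)
  by_cases hb1 : (r b).1 = 1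
  · exfalso
    rcases lt_or_gt_of_ne hab with hlt | hlt
    · obtain ⟨k, hk⟩ := exists_of_card_pos _ 3 (by rw [ca 3]; decide)
      have hle := h2 a b hlt k (by rw [ha1, hb1])
      rw [hk] at hle
      exact wb3 k (le_antisymm (Fin.le_last _) hle)
    · obtain ⟨k, hk⟩ := exists_of_card_pos _ 0 (by rw [ca 0]; decide)
      have hle := h2 b a hlt k (by rw [ha1, hb1])
      rw [hk] at hle
      exact wb0 k (le_antisymm hle (Fin.zero_le _))
  · obtain ⟨hmov, hfix, k, hk⟩ := transposition_served (r b) 1 2 (h1 b) hb1 (by rw [cb 2]; rfl)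
      (fun l hl => by rw [cb l]; fin_cases l <;> first | decide | exact absurd rfl hl)
    obtain ⟨i, j, hij, hij1, hji1, hik, hjk⟩ := moved_pair (r b).1 k hb1 hk
    have hi1 : (r b).2 i = 1 := hmov i (by rw [hij1]; exact hij.symm)
    have hj1 : (r b).2 j = 1 := hmov j (by rw [hji1]; exact hij)
    have hk2 : (r b).2 k = 2 := hfix k hk
    rcases lt_or_gt_of_ne hab with hlt | hlt
    · -- D before T
      have hle := h2 a b hlt k (by rw [ha1, hk, Equiv.Perm.one_apply])
      rw [hk2] at hle
      have hC := h6 a b hlt ha1 i j hij hij1 hji1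
      rw [hi1] at hC
      rcases f4_a _ (ua2 k) hle with hk0 | hk1
      · exfalso
        have hi0 : (r a).2 i ≠ 0 := ne_of_card_one _ 0 (by rw [ca 0]; rfl) hk0 hik
        have hj0 : (r a).2 j ≠ 0 := ne_of_card_one _ 0 (by rw [ca 0]; rfl) hk0 hjk
        have g1 := h8 b a i i (by rw [hi1]; exact f4_b _ hi0)
        have g2 := h8 b a j j (by rw [hj1]; exact f4_b _ hj0)
        rw [hi1] at g1; rw [hj1] at g2
        omega
      · have hi1' : (r a).2 i ≠ 1 := ne_of_card_one _ 1 (by rw [ca 1]; rfl) hk1 hik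
        have hj1' : (r a).2 j ≠ 1 := ne_of_card_one _ 1 (by rw [ca 1]; rfl) hk1 hjk
        have hij' : (r a).2 i ≠ (r a).2 j := by
          intro h
          have h2le := two_le_card_filter (r a) hij h
          rcases f4_c _ hj1' (ua2 j) with hj0 | hj3
          · rw [hj0, ca 0] at h2le; exact absurd h2le (by decide)
          · rw [hj3, ca 3] at h2le; exact absurd h2le (by decide)
        rcases f4_c _ hi1' (ua2 i) with hi0 | hi3 <;> rcases f4_c _ hj1' (ua2 j) with hj0 | hj3
        · exact absurd (hi0.trans hj0.symm) hij'
        · rw [hi0, hj3] at hC; omega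
        · rw [hi3, hj0] at hC; omega
        · exact absurd (hi3.trans hj3.symm) hij'
    · -- T before D: u_k = 3, then the cancellation 2 g1 < g u_i + g u_j ≤ 2 g1 is absurd
      exfalso
      have hle := h2 b a hlt k (by rw [ha1, hk, Equiv.Perm.one_apply])
      rw [hk2] at hle
      have hk3 : (r a).2 k = 3 := f4_d _ hle (ua2 k)
      have hC := h7 b a hlt ha1 i j hij hij1 hji1
      rw [hi1] at hC
      have hi3 : (r a).2 i ≠ 3 := ne_of_card_one _ 3 (by rw [ca 3]; rfl) hk3 hik
      have hj3 : (r a).2 j ≠ 3 := ne_of_card_one _ 3 (by rw [ca 3]; rfl) hk3 hjk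
      have g1 := h8 a b i i (by rw [hi1]; exact f4_e _ hi3 (ua2 i))
      have g2 := h8 a b j j (by rw [hj1]; exact f4_e _ hj3 (ua2 j))
      rw [hi1] at g1; rw [hj1] at g2
      omega

/-- **Lemma Y2** (mirror): if `{0,2,3}` and `{1,2,2}` are both carried then `2·g 2 < g 0 + g 3`. [exchange argument] -/
theorem lemmaY2 {n : ℕ} (r : Fin (n + 1) → Equiv.Perm (Fin 3) × (Fin 3 → Fin 4)) (g : Fin 4 → ℕ)
    (h1 : ∀ k i, (r k).2 ((r k).1 i) = (r k).2 i)
    (h2 : ∀ a b : Fin (n + 1), a < b → ∀ i, (r a).1 i = (r b).1 i → (r a).2 i ≤ (r b).2 i)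
    (h6 : ∀ a b : Fin (n + 1), a < b → (r a).1 = 1 → ∀ i j : Fin 3, i ≠ j → (r b).1 i = j → (r b).1 j = i →
      g ((r a).2 i) + g ((r a).2 j) < 2 * g ((r b).2 i))
    (h7 : ∀ a b : Fin (n + 1), a < b → (r b).1 = 1 → ∀ i j : Fin 3, i ≠ j → (r a).1 i = j → (r a).1 j = i →
      2 * g ((r a).2 i) < g ((r b).2 i) + g ((r b).2 j))
    (h8 : ∀ (a b : Fin (n + 1)) (i j : Fin 3), (r a).2 i ≤ (r b).2 j → g ((r a).2 i) ≤ g ((r b).2 j)) : ∀ a b : Fin (n + 1),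
    TropicalCensus.classSym (r a) = TropicalCensus.classSym ((1 : Equiv.Perm (Fin 3)), (![0, 2, 3] : Fin 3 → Fin 4)) →
    TropicalCensus.classSym (r b) = TropicalCensus.classSym ((1 : Equiv.Perm (Fin 3)), (![1, 2, 2] : Fin 3 → Fin 4)) →
    2 * g 2 < g 0 + g 3 := by
  intro a b ha hb
  have ca : ∀ l, (univ.filter fun i => (r a).2 i = l).card = (![1, 0, 1, 1] : Fin 4 → ℕ) l :=
    fun l => (card_filter_eq_of_classSym_eq ha l).trans (cnt023 l)
  have cb : ∀ l, (univ.filter fun i => (r b).2 i = l).card = (![0, 1, 2, 0] : Fin 4 → ℕ) l :=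
    fun l => (card_filter_eq_of_classSym_eq hb l).trans (cnt122 l)
  have ha1 : (r a).1 = 1 := perm_eq_one_of_card_le_one _ (h1 a) fun l => by
    rw [ca l]; fin_cases l <;> decide
  have hab : a ≠ b := by
    intro h; have := ca 0; rw [h, cb 0] at this; exact absurd this (by decide)
  have ua1 : ∀ i, (r a).2 i ≠ 1 := ne_of_card_zero _ 1 (by rw [ca 1]; rfl)
  have wb0 : ∀ i, (r b).2 i ≠ 0 := ne_of_card_zero _ 0 (by rw [cb 0]; rfl)
  have wb3 : ∀ i, (r b).2 i ≠ 3 := ne_of_card_zero _ 3 (by rw [cb 3]; rfl)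
  by_cases hb1 : (r b).1 = 1
  · exfalso
    rcases lt_or_gt_of_ne hab with hlt | hlt
    · obtain ⟨k, hk⟩ := exists_of_card_pos _ 3 (by rw [ca 3]; decide)
      have hle := h2 a b hlt k (by rw [ha1, hb1])
      rw [hk] at hle
      exact wb3 k (le_antisymm (Fin.le_last _) hle)
    · obtain ⟨k, hk⟩ := exists_of_card_pos _ 0 (by rw [ca 0]; decide)
      have hle := h2 b a hlt k (by rw [ha1, hb1])
      rw [hk] at hle
      exact wb0 k (le_antisymm hle (Fin.zero_le _))
  · obtain ⟨hmov, hfix, k, hk⟩ := transposition_served (r b) 2 1 (h1 b) hb1 (by rw [cb 1]; rfl)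
      (fun l hl => by rw [cb l]; fin_cases l <;> first | decide | exact absurd rfl hl)
    obtain ⟨i, j, hij, hij1, hji1, hik, hjk⟩ := moved_pair (r b).1 k hb1 hk
    have hi2 : (r b).2 i = 2 := hmov i (by rw [hij1]; exact hij.symm)
    have hj2 : (r b).2 j = 2 := hmov j (by rw [hji1]; exact hij)
    have hk1 : (r b).2 k = 1 := hfix k hk
    rcases lt_or_gt_of_ne hab with hlt | hlt
    · -- D before T: u_k ≤ 1 so u_k = 0; then u_i, u_j ≥ 2 and the cancellation is absurd
      exfalso
      have hle := h2 a b hlt k (by rw [ha1, hk, Equiv.Perm.one_apply])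
      rw [hk1] at hle
      have hk0 : (r a).2 k = 0 := f4_f _ hle (ua1 k)
      have hC := h6 a b hlt ha1 i j hij hij1 hji1
      rw [hi2] at hC
      have hi0 : (r a).2 i ≠ 0 := ne_of_card_one _ 0 (by rw [ca 0]; rfl) hk0 hik
      have hj0 : (r a).2 j ≠ 0 := ne_of_card_one _ 0 (by rw [ca 0]; rfl) hk0 hjk
      have g1 := h8 b a i i (by rw [hi2]; exact f4_g _ hi0 (ua1 i))
      have g2 := h8 b a j j (by rw [hj2]; exact f4_g _ hj0 (ua1 j))
      rw [hi2] at g1; rw [hj2] at g2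
      omega
    · -- T before D: 1 ≤ u_k, so u_k ∈ {2, 3}
      have hle := h2 b a hlt k (by rw [ha1, hk, Equiv.Perm.one_apply])
      rw [hk1] at hle
      have hC := h7 b a hlt ha1 i j hij hij1 hji1
      rw [hi2] at hC
      rcases f4_h _ hle (ua1 k) with hk2 | hk3
      · have hi2' : (r a).2 i ≠ 2 := ne_of_card_one _ 2 (by rw [ca 2]; rfl) hk2 hik
        have hj2' : (r a).2 j ≠ 2 := ne_of_card_one _ 2 (by rw [ca 2]; rfl) hk2 hjk
        have hij' : (r a).2 i ≠ (r a).2 j := by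
          intro h
          have h2le := two_le_card_filter (r a) hij h
          rcases f4_c _ (ua1 j) hj2' with hj0 | hj3
          · rw [hj0, ca 0] at h2le; exact absurd h2le (by decide)
          · rw [hj3, ca 3] at h2le; exact absurd h2le (by decide)
        rcases f4_c _ (ua1 i) hi2' with hi0 | hi3 <;> rcases f4_c _ (ua1 j) hj2' with hj0 | hj3
        · exact absurd (hi0.trans hj0.symm) hij'
        · rw [hi0, hj3] at hC; omega
        · rw [hi3, hj0] at hC; omega
        · exact absurd (hi3.trans hj3.symm) hij'
      · exfalso
        have hi3 : (r a).2 i ≠ 3 := ne_of_card_one _ 3 (by rw [ca 3]; rfl) hk3 hik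
        have hj3 : (r a).2 j ≠ 3 := ne_of_card_one _ 3 (by rw [ca 3]; rfl) hk3 hjk
        have g1 := h8 a b i i (by rw [hi2]; exact f4_i _ hi3)
        have g2 := h8 a b j j (by rw [hj2]; exact f4_i _ hj3)
        rw [hi2] at g1; rw [hj2] at g2
        omega

end SymmetricThreeFourSixteen

end Summit.ValiantsHypothesis.ValiantsHypothesis.Theorems.KPlusLogSqLaw
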